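import Literature.AlgebraicGeometry.Resolution.NeronPopescuReduceToField
import Literature.AlgebraicGeometry.Resolution.SmoothStandardSmoothRetract
import Literature.AlgebraicGeometry.Resolution.NeronPopescuLiftingLemma
import Literature.AlgebraicGeometry.Resolution.NeronPopescuDesingularizationCT
import HarnessLib

/-!
# Stacks 07F5 holds: PT over fields implies PT in general

Topic: `Literature/AlgebraicGeometry/Resolution`. Discharge of the named fact
`Stacks07F5_reduceToField` (`NeronPopescuSteps.lean`; The Stacks Project, *Smoothing Ring Maps*,
Lemma 07F5 = Lemma 16.8.4: "If for every Situation 07F2 where `R` is a field PT holds, then PT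
holds in general") from the proved pieces of its printed proof:

* the glue `Stacks07F5_reduceToField_of_smooth` (`NeronPopescuReduceToField.lean`: Noetherian
  induction, 07CM for the nilradical, the total ring of fractions 00EW/02LX, 07F3, 07F4, and the
  assembly with 07CP and 07CT),
* `hCI` = Lemma 07CI with 07CH (`hasStandardSmoothFactorizations_of_hasSmoothFactorizations`,
  `SmoothStandardSmoothRetract.lean`),
* `hCP` = Lemma 07CP for smooth `C̄` (`Stacks07CP_of_smooth`, `NeronPopescuLiftingLemma.lean`),
* `hCT` = Lemma 07CT for smooth `D` (`Stacks07CT_of_smooth`,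
  `NeronPopescuDesingularizationCT.lean`, from Lemma 07CR `Stacks07CR_desingularization` of
  `NeronPopescuDesingularizationLemma.lean`).

## References

* The Stacks Project, *Smoothing Ring Maps* (Tag 07BW), Lemma 07F5 and its proof. [StacksProject]
-/

namespace Literature.AlgebraicGeometry.Resolution

universe u

/-- **Stacks, Lemma 07F5 holds** ("If for every Situation 07F2 where `R` is a field PT holds,
then PT holds in general"): discharge of the named fact `Stacks07F5_reduceToField`.
[cite: StacksProject, Tag 07F5] -/
theorem Stacks07F5_reduceToField_holds : Stacks07F5_reduceToField.{u} :=
  Stacks07F5_reduceToField_of_smooth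
    (fun _ _ _ _ _ h => hasStandardSmoothFactorizations_of_hasSmoothFactorizations h)
    Stacks07CP_of_smooth Stacks07CT_of_smooth

end Literature.AlgebraicGeometry.Resolution
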